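import Summits.QuantumFields.YangMills.Theorems.ForcedResponseSkewnessRunningCouplingCeilingSmearClasses
import HarnessLib

/-!
# Crux `RunningCouplingCeiling` (stmt-QuantumFields-23617), line `pointwise-log-ceiling`: registered stub `stub_smear`
# (the smeared ceiling from pointwise kernel bounds — pure analysis)

Support file (`--supports stmt-QuantumFields-23617`) of the lead prover of route `ForcedResponseSkewness` (unit
`ym-line-frs-p1`).  `SmearSig`: for a real Schwartz `v` on `ℝ⁴` with `tsupport v ⊆ {0 < y₀} ∩ {y₀ ≤ T}` and constants
`C₀ C₁ C₂ n₀` there is `C` such that for every `Λ ≥ 2`, with `t₀ := 1/(2Λ²)` and `Λ₆ := max T 0 + 1`, every unit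
`0 < t ≤ t₀`, every torus `t·L ≥ Λ₆`, every kernel `K` with `KernelBounds C₀ C₁ C₂ n₀ t L K` and every `l ∈ [Λ, 2Λ]`:
`Σ_{x,y ∈ box L} θv((l t) x) v((l t) y) K x y ≤ C / log² Λ`.

Proof (spacing `s = l t ≤ 1/Λ`).  Every pair `(x, y)` with a non-zero term has `u = s x` in `{−T ≤ u₀ < 0}` and `w = s y` in
`{0 < w₀ ≤ T}`, so its time difference `σ/s`, `σ = |u₀| + |w₀| ≤ 2T ≤ sL`, does not wrap around the torus and the torus distance
obeys `σ ≤ s·d`.  Wall flatness with decay (`flat_decay`, `k = 8`, decay `16`) bounds `|θv(u)| |v(w)|` by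
`B² P (1+‖u‖)^{-16} (1+‖w‖)^{-16}` with `P = φ(|u₀|)⁸ φ(w₀)⁸`, `φ = min(1, ·)`, and `P ≤ σ⁸`, `P ≤ σ¹⁶`, `P ≤ 1`.  Four real-arithmetic
estimates then bound `P · (1+‖u‖)^{-16}(1+‖w‖)^{-16} · |K|` by a pair-independent weight times `(1+‖u‖)^{-8}(1+‖w‖)^{-8}`:
contact `d < n₀` (`|K| ≤ C₂`, `σ < s n₀`: `C₂ n₀¹⁶ s¹⁶`); infrared `t d > 1/2` (`|K| ≤ C₁ (2t)⁸`); window `t d ≤ 1/2` with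
`‖u‖, ‖w‖ ≤ √Λ/2` (`t d ≤ 1/√Λ`, running-coupling clause: `4C₀ s⁸/log²Λ`); tail (scale-free clause and a Schwartz tail
`(1 + √Λ/2)^{-8} ≤ 2⁸/Λ⁴`: `2⁸C₁s⁸/Λ⁴`).  The mesh-uniform Riemann bound `Σ_box (1+‖s x‖)^{-8} ≤ 256 s^{-4}` finishes with
`s⁸, (t/s)⁸, Λ^{-4} ≤ 1/log²Λ`.  (Toolkit: `…SmearToolkit` — flatness, Riemann bound, torus distance; `…SmearClasses` — the
four real-arithmetic class estimates.)

Honest label: the analysis half of a conditional rung line (leaf R2a `BalabanLadder.NT`); reusable verbatim once the crux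
gains `HasCompactSupport v`; nothing here bears on the Yang–Mills mass gap, which is NOT proved by this.
-/

set_option autoImplicit false

noncomputable section

namespace Summit.QuantumFields.YangMills.Cruxes.RunningCouplingCeiling.Pointwise

open Set Metric Filter Topology Finset
open scoped SchwartzMap
open Literature.MathematicalPhysics.QuantumLattice Literature.Probability.LatticeModels

/-! ### The per-pair estimate -/

/-- **Per-pair majorant.**  In the setting of `stub_smear` (flatness constant `B` of `v`, spacing `s = l t ≤ 1/Λ`, no time
wrap-around `2·max T 0 + 2 ≤ s L`, `s = l t`, kernel bounds at unit `t`), every term of the smeared sum is at most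
`B² Γ (1+‖s x‖)^{-8} (1+‖s y‖)^{-8}` with the pair-independent weight
`Γ = C₂⁺n₀¹⁶s¹⁶ + 2⁸C₁⁺t⁸ + 4C₀⁺s⁸/log²Λ + 2⁸C₁⁺s⁸/Λ⁴`. [folklore] -/
theorem abs_term_le (v : 𝓢(EuclideanSpace ℝ (Fin 4), ℝ)) (T : ℝ)
    (hsupp : tsupport (v : EuclideanSpace ℝ (Fin 4) → ℝ) ⊆ {y : EuclideanSpace ℝ (Fin 4) | 0 < y 0})
    (hT : tsupport (v : EuclideanSpace ℝ (Fin 4) → ℝ) ⊆ {y : EuclideanSpace ℝ (Fin 4) | y 0 ≤ T})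
    {B : ℝ} (hB0 : 0 ≤ B)
    (hB : ∀ w : EuclideanSpace ℝ (Fin 4), |v w| ≤ B * (min 1 (max (w 0) 0)) ^ 8 * ((1 + ‖w‖) ^ 16)⁻¹)
    (C₀ C₁ C₂ : ℝ) (n₀ : ℕ) {Λ t l : ℝ} (hΛ : 2 ≤ Λ) (ht : 0 < t) (hl : Λ ≤ l)
    (L : ℕ) (hL : 2 * max T 0 + 2 ≤ l * t * L)
    (K : (Fin 4 → ℤ) → (Fin 4 → ℤ) → ℝ) (hK : KernelBounds C₀ C₁ C₂ n₀ t L K)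
    (x y : Fin 4 → ℤ) (hx : x ∈ box 4 L) (hy : y ∈ box 4 L) :
    |(thetaTest 4 v) ((l * t) • siteToE x) * v ((l * t) • siteToE y) * K x y| ≤
      B ^ 2 * (max C₂ 0 * (n₀ : ℝ) ^ 16 * (l * t) ^ 16 + 2 ^ 8 * max C₁ 0 * t ^ 8 +
          4 * max C₀ 0 * (l * t) ^ 8 / Real.log Λ ^ 2 + 2 ^ 8 * max C₁ 0 * (l * t) ^ 8 / Λ ^ 4) *
        (((1 + ‖(l * t) • siteToE x‖) ^ 8)⁻¹ * ((1 + ‖(l * t) • siteToE y‖) ^ 8)⁻¹) := by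
  -- names
  set s : ℝ := l * t with hs_def
  set u : EuclideanSpace ℝ (Fin 4) := s • siteToE x with hu
  set w : EuclideanSpace ℝ (Fin 4) := s • siteToE y with hw
  set d : ℝ := torusDist L x y with hd
  have hΛpos : 0 < Λ := by linarith
  have hlpos : 0 < l := by linarith
  have hspos : 0 < s := mul_pos hlpos ht
  have hC₀'0 : 0 ≤ max C₀ 0 := le_max_right _ _
  have hC₁'0 : 0 ≤ max C₁ 0 := le_max_right _ _
  have hC₂'0 : 0 ≤ max C₂ 0 := le_max_right _ _
  have hΓa : 0 ≤ max C₂ 0 * (n₀ : ℝ) ^ 16 * s ^ 16 := by positivity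
  have hΓb : 0 ≤ 2 ^ 8 * max C₁ 0 * t ^ 8 := by positivity
  have hΓc : 0 ≤ 4 * max C₀ 0 * s ^ 8 / Real.log Λ ^ 2 := by positivity
  have hΓd : 0 ≤ 2 ^ 8 * max C₁ 0 * s ^ 8 / Λ ^ 4 := by positivity
  set Γ : ℝ := max C₂ 0 * (n₀ : ℝ) ^ 16 * s ^ 16 + 2 ^ 8 * max C₁ 0 * t ^ 8 +
    4 * max C₀ 0 * s ^ 8 / Real.log Λ ^ 2 + 2 ^ 8 * max C₁ 0 * s ^ 8 / Λ ^ 4 with hΓ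
  have hΓ0 : 0 ≤ Γ := by positivity
  set bu : ℝ := ((1 + ‖u‖) ^ 8)⁻¹ with hbu
  set bw : ℝ := ((1 + ‖w‖) ^ 8)⁻¹ with hbw
  set b16u : ℝ := ((1 + ‖u‖) ^ 16)⁻¹ with hb16u_def
  set b16w : ℝ := ((1 + ‖w‖) ^ 16)⁻¹ with hb16w_def
  have hbu0 : 0 ≤ bu := inv_nonneg.2 (by positivity)
  have hbw0 : 0 ≤ bw := inv_nonneg.2 (by positivity)
  have hb16u : b16u ≤ bu := bracket16_le_bracket8 ‖u‖ (norm_nonneg _)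
  have hb16w : b16w ≤ bw := bracket16_le_bracket8 ‖w‖ (norm_nonneg _)
  have hb16u0 : 0 ≤ b16u := inv_nonneg.2 (by positivity)
  have hb16w0 : 0 ≤ b16w := inv_nonneg.2 (by positivity)
  have hRHS0 : 0 ≤ B ^ 2 * Γ * (bu * bw) := by positivity
  show |(thetaTest 4 v) u * v w * K x y| ≤ B ^ 2 * Γ * (bu * bw)
  -- the zero cases
  by_cases hvu : (thetaTest 4 v) u = 0
  · rw [hvu, zero_mul, zero_mul, abs_zero]; exact hRHS0
  by_cases hvw : v w = 0
  · rw [hvw, mul_zero, zero_mul, abs_zero]; exact hRHS0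
  -- support information: `−T ≤ u₀ < 0 < w₀ ≤ T`
  rw [thetaTest_apply] at hvu
  have hθu : timeReflection 4 u ∈ tsupport (v : EuclideanSpace ℝ (Fin 4) → ℝ) := subset_tsupport _ hvu
  have hwt : w ∈ tsupport (v : EuclideanSpace ℝ (Fin 4) → ℝ) := subset_tsupport _ hvw
  have hθ0 : (timeReflection 4 u) 0 = -u 0 := by simp
  have hu0 : u 0 < 0 := by have h := hsupp hθu; simp only [mem_setOf_eq, hθ0] at h; linarith
  have huT : -u 0 ≤ T := by have h := hT hθu; simp only [mem_setOf_eq, hθ0] at h; exact h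
  have hw0 : 0 < w 0 := hsupp hwt
  have hwT : w 0 ≤ T := hT hwt
  -- flatness bounds and their product
  set P : ℝ := (min 1 (max (-u 0) 0)) ^ 8 * (min 1 (max (w 0) 0)) ^ 8 with hP
  have hφu0 : 0 ≤ min 1 (max (-u 0) 0) := le_min zero_le_one (le_max_right _ _)
  have hφw0 : 0 ≤ min 1 (max (w 0) 0) := le_min zero_le_one (le_max_right _ _)
  have hP0 : 0 ≤ P := mul_nonneg (pow_nonneg hφu0 8) (pow_nonneg hφw0 8)
  have hP1 : P ≤ 1 := by
    calc P ≤ 1 * 1 := mul_le_mul (pow_le_one₀ hφu0 (min_le_left _ _)) (pow_le_one₀ hφw0 (min_le_left _ _))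
          (pow_nonneg hφw0 8) zero_le_one
      _ = 1 := one_mul _
  have hprod : |(thetaTest 4 v) u| * |v w| ≤ B ^ 2 * P * (b16u * b16w) := by
    have hθuB : |(thetaTest 4 v) u| ≤ B * (min 1 (max (-u 0) 0)) ^ 8 * b16u := by
      rw [thetaTest_apply]
      have h := hB (timeReflection 4 u)
      rwa [hθ0, LinearIsometryEquiv.norm_map] at h
    calc |(thetaTest 4 v) u| * |v w|
        ≤ (B * (min 1 (max (-u 0) 0)) ^ 8 * b16u) * (B * (min 1 (max (w 0) 0)) ^ 8 * b16w) :=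
          mul_le_mul hθuB (hB w) (abs_nonneg _) (by positivity)
      _ = B ^ 2 * P * (b16u * b16w) := by rw [hP]; ring
  -- the time separation `σ` and no wrap-around
  set σ : ℝ := w 0 - u 0 with hσ
  have hσpos : 0 < σ := by rw [hσ]; linarith
  have hu0x : u 0 = s * (x 0 : ℝ) := by
    rw [hu, PiLp.smul_apply, siteToE_apply, smul_eq_mul]
  have hw0y : w 0 = s * (y 0 : ℝ) := by
    rw [hw, PiLp.smul_apply, siteToE_apply, smul_eq_mul]
  have hx0 : (x 0 : ℝ) < 0 := by
    by_contra h; rw [not_lt] at h; have := mul_nonneg hspos.le h; linarith [hu0x]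
  have hσxy : σ = s * |((x 0 - y 0 : ℤ) : ℝ)| := by
    have hy0 : 0 < (y 0 : ℝ) := by
      by_contra h; rw [not_lt] at h; have := mul_nonpos_of_nonneg_of_nonpos hspos.le h
      rw [← hw0y] at this; linarith
    push_cast
    rw [abs_of_neg (by linarith), hσ, hu0x, hw0y]; ring
  have hxyL : |x 0 - y 0| ≤ (L : ℤ) := by
    have h0 : σ ≤ s * L := by
      rw [hσ]; linarith [le_max_left T 0]
    have h1 : s * |((x 0 - y 0 : ℤ) : ℝ)| ≤ s * L := by rwa [← hσxy]
    have h2 : |((x 0 - y 0 : ℤ) : ℝ)| ≤ L := le_of_mul_le_mul_left h1 hspos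
    exact_mod_cast h2
  have hσd : σ ≤ s * d := by
    rw [hσxy]
    exact mul_le_mul_of_nonneg_left (by exact_mod_cast abs_sub_le_torusDist L x y hxyL) hspos.le
  have hdpos : 0 < d := by
    by_contra h; rw [not_lt] at h; have := mul_nonpos_of_nonneg_of_nonpos hspos.le h; linarith
  have hPσ8 : P ≤ σ ^ 8 := by
    have h := phi_pow_mul_phi_pow_le (a := -u 0) (b := w 0) (by linarith) hw0.le
    rwa [show -u 0 + w 0 = σ by rw [hσ]; ring] at h
  have hPσ16 : P ≤ σ ^ 16 := by
    calc P ≤ σ ^ 8 * σ ^ 8 := mul_le_mul (phi_pow_le (by linarith) (by rw [hσ]; linarith))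
          (phi_pow_le hw0.le (by rw [hσ]; linarith)) (pow_nonneg hφw0 8) (pow_nonneg hσpos.le 8)
      _ = σ ^ 16 := by ring
  -- reduce to the kernel part
  obtain ⟨hK2, hK1, hK0⟩ := hK x hx y hy
  have hfin : ∀ {S : ℝ}, P * (b16u * b16w) * |K x y| ≤ S * (bu * bw) → S ≤ Γ →
      |(thetaTest 4 v) u * v w * K x y| ≤ B ^ 2 * Γ * (bu * bw) := by
    intro S hS hSΓ
    rw [abs_mul, abs_mul]
    calc |(thetaTest 4 v) u| * |v w| * |K x y| ≤ B ^ 2 * P * (b16u * b16w) * |K x y| :=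
          mul_le_mul_of_nonneg_right hprod (abs_nonneg _)
      _ = B ^ 2 * (P * (b16u * b16w) * |K x y|) := by ring
      _ ≤ B ^ 2 * (S * (bu * bw)) := mul_le_mul_of_nonneg_left hS (sq_nonneg _)
      _ ≤ B ^ 2 * (Γ * (bu * bw)) :=
          mul_le_mul_of_nonneg_left (mul_le_mul_of_nonneg_right hSΓ (mul_nonneg hbu0 hbw0)) (sq_nonneg _)
      _ = B ^ 2 * Γ * (bu * bw) := by ring
  -- CASE SPLIT
  rcases lt_or_ge d (n₀ : ℝ) with hdn | hdn
  · -- contact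
    exact hfin (est_contact hPσ16 hσpos hspos hσd hdn (hK2.trans (le_max_left _ _))
      hb16u hb16w hb16u0 hb16w0) (by rw [hΓ]; linarith)
  rcases lt_or_ge (1 / 2 : ℝ) (t * d) with htd | htd
  · -- infrared
    exact hfin (est_infrared hP1 hdpos htd ((hK1 hdn).trans (le_max_left _ _)) hC₁'0
      hb16u hb16w hb16u0 hb16w0) (by rw [hΓ]; linarith)
  by_cases hwin : ‖u‖ ≤ Real.sqrt Λ / 2 ∧ ‖w‖ ≤ Real.sqrt Λ / 2
  · -- window: `t d ≤ 1/√Λ`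
    have hsqrt : 0 < Real.sqrt Λ := Real.sqrt_pos.2 hΛpos
    have hsq : Real.sqrt Λ * Real.sqrt Λ = Λ := Real.mul_self_sqrt hΛpos.le
    have hduw : d * s ≤ ‖u‖ + ‖w‖ := by
      calc d * s = s * torusDist L x y := by rw [hd, mul_comm]
        _ ≤ s * ‖siteToE x - siteToE y‖ := mul_le_mul_of_nonneg_left (torusDist_le_norm_sub L x y) hspos.le
        _ = ‖u - w‖ := by rw [hu, hw, ← smul_sub, norm_smul, Real.norm_eq_abs, abs_of_pos hspos]
        _ ≤ ‖u‖ + ‖w‖ := norm_sub_le _ _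
    have htdΛ : t * d ≤ 1 / Real.sqrt Λ := by
      have h1 : t * d * l ≤ Real.sqrt Λ := by
        calc t * d * l = d * s := by rw [hs_def]; ring
          _ ≤ ‖u‖ + ‖w‖ := hduw
          _ ≤ Real.sqrt Λ := by linarith [hwin.1, hwin.2]
      have h2 : t * d * Λ ≤ t * d * l := mul_le_mul_of_nonneg_left hl (mul_pos ht hdpos).le
      have h1' : 1 ≤ Real.sqrt Λ := by
        rw [show (1 : ℝ) = Real.sqrt 1 by rw [Real.sqrt_one]]
        exact Real.sqrt_le_sqrt (by linarith)
      rw [le_div_iff₀ hsqrt]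
      have h3 : t * d * Real.sqrt Λ * Real.sqrt Λ ≤ 1 * Real.sqrt Λ := by
        calc t * d * Real.sqrt Λ * Real.sqrt Λ = t * d * Λ := by rw [mul_assoc, hsq]
          _ ≤ Real.sqrt Λ := h2.trans h1
          _ = 1 * Real.sqrt Λ := (one_mul _).symm
      have := le_of_mul_le_mul_right h3 hsqrt
      linarith
    exact hfin (est_window hP0 hPσ8 hσpos hdpos hσd ht hΛ htdΛ (hK0 hdn htd) (le_max_left _ _) hC₀'0
      hb16u hb16w hb16u0 hb16w0) (by rw [hΓ]; linarith)
  · -- tail: one of `‖u‖, ‖w‖` exceeds `R = √Λ/2`, and `(1+R)^{-8} ≤ 2⁸/Λ⁴`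
    set R : ℝ := Real.sqrt Λ / 2 with hR
    have hR0 : 0 ≤ R := by rw [hR]; positivity
    have hRΛ : ((1 + R) ^ 8)⁻¹ ≤ 2 ^ 8 / Λ ^ 4 := by
      have hRpos : 0 < R := by rw [hR]; exact div_pos (Real.sqrt_pos.2 hΛpos) two_pos
      have h1 : R ^ 8 = Λ ^ 4 / 2 ^ 8 := by
        rw [hR, div_pow, show (8 : ℕ) = 2 * 4 by norm_num, pow_mul, Real.sq_sqrt hΛpos.le]
      calc ((1 + R) ^ 8)⁻¹ ≤ (R ^ 8)⁻¹ := inv_anti₀ (by positivity) (pow_le_pow_left₀ hR0 (by linarith) 8)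
        _ = 2 ^ 8 / Λ ^ 4 := by rw [h1, inv_div]
    have htail : b16u * b16w ≤ 2 ^ 8 / Λ ^ 4 * (bu * bw) := by
      rw [not_and_or, not_le, not_le] at hwin
      rcases hwin with hbig | hbig
      · calc b16u * b16w ≤ (((1 + R) ^ 8)⁻¹ * bu) * bw :=
            mul_le_mul (bracket16_le_tail hR0 hbig) hb16w hb16w0 (by positivity)
          _ = ((1 + R) ^ 8)⁻¹ * (bu * bw) := by ring
          _ ≤ 2 ^ 8 / Λ ^ 4 * (bu * bw) := mul_le_mul_of_nonneg_right hRΛ (mul_nonneg hbu0 hbw0)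
      · calc b16u * b16w ≤ bu * (((1 + R) ^ 8)⁻¹ * bw) :=
            mul_le_mul hb16u (bracket16_le_tail hR0 hbig) hb16w0 hbu0
          _ = ((1 + R) ^ 8)⁻¹ * (bu * bw) := by ring
          _ ≤ 2 ^ 8 / Λ ^ 4 * (bu * bw) := mul_le_mul_of_nonneg_right hRΛ (mul_nonneg hbu0 hbw0)
    exact hfin (est_tail hP0 hPσ8 hσpos hdpos hσd ((hK1 hdn).trans (le_max_left _ _)) hC₁'0 htail
      (mul_nonneg hbu0 hbw0)) (by rw [hΓ]; linarith)

/-! ### The registered stub -/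

/-- **Registered stub `stub_smear` of line `pointwise-log-ceiling`** (crux `RunningCouplingCeiling`, stmt-QuantumFields-23617):
the smeared ceiling `Σ θv ⊗ v · K ≤ C/log²Λ` from the pointwise kernel bounds, for Schwartz `v` supported in
`{0 < y₀} ∩ {y₀ ≤ T}` (thresholds `t₀ = 1/(2Λ²)`, `Λ₆ = max T 0 + 1`). [folklore] -/
theorem stub_smear : SmearSig := by
  intro v T hsupp hT C₀ C₁ C₂ n₀
  obtain ⟨B, hB0, hB⟩ := flat_decay 8 v hsupp
  set C₀' : ℝ := max C₀ 0 with hC₀'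
  set C₁' : ℝ := max C₁ 0 with hC₁'
  set C₂' : ℝ := max C₂ 0 with hC₂'
  have hC₀'0 : 0 ≤ C₀' := le_max_right _ _
  have hC₁'0 : 0 ≤ C₁' := le_max_right _ _
  have hC₂'0 : 0 ≤ C₂' := le_max_right _ _
  refine ⟨2 ^ 16 * B ^ 2 * (C₂' * (n₀ : ℝ) ^ 16 + 2 ^ 8 * C₁' + 4 * C₀' + 2 ^ 8 * C₁'), fun Λ hΛ => ?_⟩
  have hΛpos : 0 < Λ := by linarith
  have hΛ1 : 1 ≤ Λ := by linarith
  have hlog : 0 < Real.log Λ := Real.log_pos (by linarith)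
  refine ⟨1 / (2 * Λ ^ 2), max T 0 + 1, by positivity, ?_⟩
  intro t ht htt L hL K hK l hl
  obtain ⟨hl1, hl2⟩ := hl
  set s : ℝ := l * t with hs
  have hlpos : 0 < l := by linarith
  have hspos : 0 < s := mul_pos hlpos ht
  have hsΛ : s ≤ 1 / Λ := by
    calc s = l * t := hs
      _ ≤ (2 * Λ) * (1 / (2 * Λ ^ 2)) := mul_le_mul hl2 htt ht.le (by positivity)
      _ = 1 / Λ := by field_simp
  have hs1 : s ≤ 1 := hsΛ.trans (by rw [div_le_one hΛpos]; exact hΛ1)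
  have hsL : 2 * max T 0 + 2 ≤ s * L := by
    calc 2 * max T 0 + 2 = 2 * (max T 0 + 1) := by ring
      _ ≤ l * (t * L) := mul_le_mul (by linarith) hL (by positivity) hlpos.le
      _ = s * L := by rw [hs]; ring
  -- the per-pair majorant and the two Riemann sums
  set Γ : ℝ := C₂' * (n₀ : ℝ) ^ 16 * s ^ 16 + 2 ^ 8 * C₁' * t ^ 8 + 4 * C₀' * s ^ 8 / Real.log Λ ^ 2 +
    2 ^ 8 * C₁' * s ^ 8 / Λ ^ 4 with hΓ
  have hΓ0 : 0 ≤ Γ := by rw [hΓ]; positivity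
  have hpair : ∀ x ∈ box 4 L, ∀ y ∈ box 4 L,
      (thetaTest 4 v) (s • siteToE x) * v (s • siteToE y) * K x y ≤
        B ^ 2 * Γ * (((1 + ‖s • siteToE x‖) ^ 8)⁻¹ * ((1 + ‖s • siteToE y‖) ^ 8)⁻¹) := by
    intro x hx y hy
    exact (le_abs_self _).trans
      (abs_term_le v T hsupp hT hB0 hB C₀ C₁ C₂ n₀ hΛ ht hl1 L hsL K hK x y hx hy)
  have hRiem := sum_box_bracket_le hspos hs1 L
  have hsum : ∑ x ∈ box 4 L, ∑ y ∈ box 4 L, (thetaTest 4 v) (s • siteToE x) * v (s • siteToE y) * K x y ≤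
      B ^ 2 * Γ * (256 * (s ^ 4)⁻¹) ^ 2 := by
    calc ∑ x ∈ box 4 L, ∑ y ∈ box 4 L, (thetaTest 4 v) (s • siteToE x) * v (s • siteToE y) * K x y
        ≤ ∑ x ∈ box 4 L, ∑ y ∈ box 4 L,
            B ^ 2 * Γ * (((1 + ‖s • siteToE x‖) ^ 8)⁻¹ * ((1 + ‖s • siteToE y‖) ^ 8)⁻¹) :=
          Finset.sum_le_sum fun x hx => Finset.sum_le_sum fun y hy => hpair x hx y hy
      _ = B ^ 2 * Γ * ((∑ x ∈ box 4 L, ((1 + ‖s • siteToE x‖) ^ 8)⁻¹) *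
            (∑ y ∈ box 4 L, ((1 + ‖s • siteToE y‖) ^ 8)⁻¹)) := by
          rw [Finset.sum_mul_sum, Finset.mul_sum]
          refine Finset.sum_congr rfl fun x _ => ?_
          rw [Finset.mul_sum]
      _ ≤ B ^ 2 * Γ * ((256 * (s ^ 4)⁻¹) * (256 * (s ^ 4)⁻¹)) := by gcongr
      _ = B ^ 2 * Γ * (256 * (s ^ 4)⁻¹) ^ 2 := by ring
  refine hsum.trans ?_
  -- constant bookkeeping: `Γ · 2^16 s^{-8} ≤ (C₂'n₀¹⁶ + 2⁸C₁' + 4C₀' + 2⁸C₁')/log²Λ`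
  have hlogΛ2 : Real.log Λ ^ 2 ≤ Λ ^ 2 := log_sq_le_sq hΛ1
  have hΛ2le4 : Λ ^ 2 ≤ Λ ^ 4 := pow_le_pow_right₀ hΛ1 (by norm_num)
  have hΛ2le8 : Λ ^ 2 ≤ Λ ^ 8 := pow_le_pow_right₀ hΛ1 (by norm_num)
  have hs8 : s ^ 8 ≤ 1 / Real.log Λ ^ 2 := by
    calc s ^ 8 ≤ (1 / Λ) ^ 8 := pow_le_pow_left₀ hspos.le hsΛ 8
      _ = 1 / Λ ^ 8 := by rw [div_pow, one_pow]
      _ ≤ 1 / Real.log Λ ^ 2 := div_le_div_of_nonneg_left zero_le_one (by positivity) (hlogΛ2.trans hΛ2le8)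
  have hts8 : t ^ 8 * (s ^ 8)⁻¹ ≤ 1 / Real.log Λ ^ 2 := by
    have h1 : t ^ 8 * (s ^ 8)⁻¹ = 1 / l ^ 8 := by
      rw [hs, mul_pow]; field_simp
    rw [h1]
    calc 1 / l ^ 8 ≤ 1 / Λ ^ 8 := div_le_div_of_nonneg_left zero_le_one (by positivity)
          (pow_le_pow_left₀ hΛpos.le hl1 8)
      _ ≤ 1 / Real.log Λ ^ 2 := div_le_div_of_nonneg_left zero_le_one (by positivity) (hlogΛ2.trans hΛ2le8)
  have hΛ4 : 1 / Λ ^ 4 ≤ 1 / Real.log Λ ^ 2 :=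
    div_le_div_of_nonneg_left zero_le_one (by positivity) (hlogΛ2.trans hΛ2le4)
  have hs80 : 0 < s ^ 8 := by positivity
  have hkey : Γ * (s ^ 8)⁻¹ ≤ (C₂' * (n₀ : ℝ) ^ 16 + 2 ^ 8 * C₁' + 4 * C₀' + 2 ^ 8 * C₁') / Real.log Λ ^ 2 := by
    have e : Γ * (s ^ 8)⁻¹ = C₂' * (n₀ : ℝ) ^ 16 * s ^ 8 + 2 ^ 8 * C₁' * (t ^ 8 * (s ^ 8)⁻¹) +
        4 * C₀' * (1 / Real.log Λ ^ 2) + 2 ^ 8 * C₁' * (1 / Λ ^ 4) := by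
      rw [hΓ]; field_simp
    rw [e]
    have h1 : C₂' * (n₀ : ℝ) ^ 16 * s ^ 8 ≤ C₂' * (n₀ : ℝ) ^ 16 * (1 / Real.log Λ ^ 2) :=
      mul_le_mul_of_nonneg_left hs8 (by positivity)
    have h2 : 2 ^ 8 * C₁' * (t ^ 8 * (s ^ 8)⁻¹) ≤ 2 ^ 8 * C₁' * (1 / Real.log Λ ^ 2) :=
      mul_le_mul_of_nonneg_left hts8 (by positivity)
    have h4 : 2 ^ 8 * C₁' * (1 / Λ ^ 4) ≤ 2 ^ 8 * C₁' * (1 / Real.log Λ ^ 2) :=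
      mul_le_mul_of_nonneg_left hΛ4 (by positivity)
    have e2 : (C₂' * (n₀ : ℝ) ^ 16 + 2 ^ 8 * C₁' + 4 * C₀' + 2 ^ 8 * C₁') / Real.log Λ ^ 2 =
        C₂' * (n₀ : ℝ) ^ 16 * (1 / Real.log Λ ^ 2) + 2 ^ 8 * C₁' * (1 / Real.log Λ ^ 2) +
          4 * C₀' * (1 / Real.log Λ ^ 2) + 2 ^ 8 * C₁' * (1 / Real.log Λ ^ 2) := by
      field_simp
    rw [e2]
    linarith
  calc B ^ 2 * Γ * (256 * (s ^ 4)⁻¹) ^ 2 = 2 ^ 16 * B ^ 2 * (Γ * (s ^ 8)⁻¹) := by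
        field_simp; ring
    _ ≤ 2 ^ 16 * B ^ 2 * ((C₂' * (n₀ : ℝ) ^ 16 + 2 ^ 8 * C₁' + 4 * C₀' + 2 ^ 8 * C₁') / Real.log Λ ^ 2) :=
        mul_le_mul_of_nonneg_left hkey (by positivity)
    _ = 2 ^ 16 * B ^ 2 * (C₂' * (n₀ : ℝ) ^ 16 + 2 ^ 8 * C₁' + 4 * C₀' + 2 ^ 8 * C₁') / Real.log Λ ^ 2 := by
        ring

end Summit.QuantumFields.YangMills.Cruxes.RunningCouplingCeiling.Pointwise

end
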